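import Mathlib
import Literature.AlgebraicGeometry.Resolution.PointBlowupFlagStepTyped
import Literature.AlgebraicGeometry.Resolution.PointBlowupFlagDropMonomialStep
import Summits.ResolutionOfSingularities.ResolutionOfSingularities.Theorems.WeightedInvariantLocalWeightedDropWildMonicFlagDropAxisSplit
import Summits.ResolutionOfSingularities.ResolutionOfSingularities.Theorems.WeightedInvariantLocalWeightedDropWildMonicShiftOrder

/-!
# `WeightedInvariant.LocalWeightedDrop`, line `hasse-ridge-face-selection`, S3ρ: INDUCED HYPERSURFACES — the axis successor of a re-centred
# parent is the re-centred axis successor (tool for every DropAxis hand: Per17 Prop 9.1.1's induced flag on the tuples)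

Crux item stmt-ResolutionOfSingularities-8899 `LocalWeightedDrop` (route `ResolutionOfSingularities/WeightedInvariant`), engine of the door
`HypersurfaceCentreConstruction` stmt-ResolutionOfSingularities-19897.  [OURS · L1 W4.3, chain w43, res-type-083 (S3ρ first seat, (C9) lead).
MAP: S. Perlega, arXiv:2011.14443 Prop 9.1.1 p0103 («the induced flag `F′` … consists of the strict transform `F₂′` of `F₂` and of the strict
transform `F₁′` of `F₁`»): on the tuples, the hypersurface `y + g(x₁,x₂)` of the parent induces the hypersurface `y′ + g′` of the child with
`x · g′ = g(x, x y′)`.  Every object OURS; not a statement of any manuscript.]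

* `shift_scale` — homogeneity of the Taylor shift: `shift d (c^{d-j} · T_j)_j (c·g) = (c^{d-j} · shift d T g _j)_j`;
* `exists_dirChart_zero_eq_X_mul` — for `g(0) = 0`: `g(x, xy′) = x · g′` with `g′(0) =` the `x₁`-linear coefficient of `g`
  (so `g′` is a legal re-centring iff that coefficient vanishes — automatic for an `ord`-clean `g` at a strict position);
* `axisSuccessor_shift` — **`x^{d-j} · (shift d T g′)_j = (shift d A g)_j(x, x y′)`**: if `T` is the axis successor of `A`, then `shift d T g′` is
  the axis successor of `shift d A g` — the induced flag `(g′, h)` of the child for the parent flag `(g, X·h)` (combine with the shear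
  commutation `dirChart 0 ∘ shift(X·h) = shift(h) ∘ dirChart 0` for `h ≠ 0`).
-/

set_option linter.dupNamespace false -- mandated namespace of this single-conjunct summit

noncomputable section

namespace Summit.ResolutionOfSingularities.ResolutionOfSingularities.Theorems

open Literature.AlgebraicGeometry.Resolution

namespace WildMonic

open MvPowerSeries

variable {k : Type} [Field k] {d : ℕ}

/-- HOMOGENEITY OF THE TAYLOR SHIFT: scaling slot `j` by `c^{d-j}` and the germ by `c` scales the shifted slot `j` by `c^{d-j}`
(`(c y)^d + Σ c^{d-j} T_j (c y)^j = c^d (y^d + Σ T_j y^j)`). -/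
theorem shift_scale {R : Type*} [CommRing R] (c : R) (T : Fin d → R) (g : R) (i : Fin d) :
    shift d (fun j => c ^ (d - (j : ℕ)) * T j) (c * g) i = c ^ (d - (i : ℕ)) * shift d T g i := by
  rw [shift_eq, shift_eq, mul_add, Finset.mul_sum, mul_pow]
  congr 1
  · ring
  · refine Finset.sum_congr rfl fun j _ => ?_
    by_cases hij : (i : ℕ) ≤ j
    · have hc : c ^ (d - (j : ℕ)) * c ^ ((j : ℕ) - i) = c ^ (d - (i : ℕ)) := by
        rw [← pow_add]
        congr 1
        have := j.2
        omega
      rw [mul_pow]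
      calc ((j : ℕ).choose i : R) * (c ^ (d - (j : ℕ)) * T j) * (c ^ ((j : ℕ) - i) * g ^ ((j : ℕ) - i))
          = (c ^ (d - (j : ℕ)) * c ^ ((j : ℕ) - i)) * (((j : ℕ).choose i : R) * T j * g ^ ((j : ℕ) - i)) := by ring
        _ = c ^ (d - (i : ℕ)) * (((j : ℕ).choose i : R) * T j * g ^ ((j : ℕ) - i)) := by rw [hc]
    · rw [Nat.choose_eq_zero_of_lt (by omega), Nat.cast_zero]
      simp

/-- `g(x, x y′) = x · g′` for `g(0) = 0`, with `g′(0) =` the coefficient of `x₁` in `g`. -/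
theorem exists_dirChart_zero_eq_X_mul (g : MvPowerSeries (Fin 2) k) (hg : constantCoeff g = 0) :
    ∃ g' : MvPowerSeries (Fin 2) k, subst (PlaneGerm.dirChart (0 : k)) g = X 0 * g' ∧
      constantCoeff g' = coeff (Finsupp.single 0 1) g := by
  rw [← HauserPerlega2024.step_eq_dirChart_zero]
  have hdvd : (X 0 : MvPowerSeries (Fin 2) k) ∣ subst (fun l : Fin 2 => if l = (1 : Fin 2) then
      (X 0 : MvPowerSeries (Fin 2) k) * X 1 else X l) g := by
    refine X_dvd_iff.mpr fun m hm => ?_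
    rw [HauserPerlega2024.coeff_subst_step (0 : Fin 2) 1 (by decide) (fun l : Fin 2 => by fin_cases l <;> simp) g m]
    split_ifs with hle
    · have h1 : m 1 = 0 := by omega
      rw [hm, h1, Nat.sub_zero, Finsupp.single_zero, Finsupp.single_zero, add_zero, coeff_zero_eq_constantCoeff_apply, hg]
    · rfl
  obtain ⟨g', hg'⟩ := hdvd
  refine ⟨g', hg', ?_⟩
  have h := HauserPerlega2024.coeff_subst_step (0 : Fin 2) 1 (by decide) (fun l : Fin 2 => by fin_cases l <;> simp) g (Finsupp.single 0 1)
  have e0 : (Finsupp.single (0 : Fin 2) 1 : Fin 2 →₀ ℕ) 0 = 1 := by simp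
  have e1 : (Finsupp.single (0 : Fin 2) 1 : Fin 2 →₀ ℕ) 1 = 0 := by simp
  rw [hg', e0, e1, if_pos (Nat.zero_le _), Nat.sub_zero, Finsupp.single_zero, add_zero] at h
  rw [← h]
  have hs : (Finsupp.single (0 : Fin 2) 1 : Fin 2 →₀ ℕ) = Finsupp.single 0 1 + 0 := (add_zero _).symm
  conv_rhs => rw [hs, show (X 0 : MvPowerSeries (Fin 2) k) = monomial (Finsupp.single 0 1) 1 from rfl, coeff_add_monomial_mul, one_mul]
  exact (coeff_zero_eq_constantCoeff_apply g').symm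

/-- **THE AXIS SUCCESSOR OF A RE-CENTRED PARENT IS THE RE-CENTRED AXIS SUCCESSOR**: if `x^{d-j}·T_j = A_j(x, xy′)` for all `j` and
`x·g′ = g(x, xy′)`, then `x^{d-j}·(shift d T g′)_j = (shift d A g)_j(x, xy′)` for all `j` — the induced hypersurface of the child. -/
theorem axisSuccessor_shift {A T : Fin d → MvPowerSeries (Fin 2) k}
    (hT : ∀ j : Fin d, X 0 ^ (d - (j : ℕ)) * T j = subst (PlaneGerm.dirChart (0 : k)) (A j))
    {g g' : MvPowerSeries (Fin 2) k} (hg' : subst (PlaneGerm.dirChart (0 : k)) g = X 0 * g') (j : Fin d) :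
    X 0 ^ (d - (j : ℕ)) * shift d T g' j = subst (PlaneGerm.dirChart (0 : k)) (shift d A g j) := by
  rw [subst_shift (PlaneGerm.hasSubst_dirChart (0 : k)) A g j, hg']
  have hfun : (fun i : Fin d => subst (PlaneGerm.dirChart (0 : k)) (A i)) = fun i : Fin d => X 0 ^ (d - (i : ℕ)) * T i :=
    funext fun i => (hT i).symm
  rw [hfun, shift_scale]

/-- The same at a TRANSLATED point `t`: `x^{d-j}·(shift d T g′)_j = (shift d A g)_j(x, x(t + y′))` when `x·g′ = g(x, x(t+y′))`. -/
theorem dirChart_successor_shift (t : k) {A T : Fin d → MvPowerSeries (Fin 2) k}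
    (hT : ∀ j : Fin d, X 0 ^ (d - (j : ℕ)) * T j = subst (PlaneGerm.dirChart t) (A j))
    {g g' : MvPowerSeries (Fin 2) k} (hg' : subst (PlaneGerm.dirChart t) g = X 0 * g') (j : Fin d) :
    X 0 ^ (d - (j : ℕ)) * shift d T g' j = subst (PlaneGerm.dirChart t) (shift d A g j) := by
  rw [subst_shift (PlaneGerm.hasSubst_dirChart t) A g j, hg']
  have hfun : (fun i : Fin d => subst (PlaneGerm.dirChart t) (A i)) = fun i : Fin d => X 0 ^ (d - (i : ℕ)) * T i :=
    funext fun i => (hT i).symm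
  rw [hfun, shift_scale]

end WildMonic

end Summit.ResolutionOfSingularities.ResolutionOfSingularities.Theorems

end
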